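import Mathlib
import Literature.Analysis.UnboundedOperators.ConjugateOperatorRegularity
import HarnessLib
import Summits.AtomisticToContinuum.FouriersLaw.Theorems.EmbeddedDrudeMourreMourreDissolutionLAPExpUnitary

/-!
# Stub `stub_mourreThresholdLAP` — Mourre LAP infrastructure 12: regularity of `e^{iτB}` for `B ∈ C¹ ∩ 𝒞^{1,1}`

Item `stmt-AtomisticToContinuum-12594` (crux `MourreDissolution` of route `EmbeddedDrudeMourre`,
sub-problem `FouriersLaw`), line `separable-vertex-faddeev-pair-sector`, stub S6
`stub_mourreThresholdLAP` (Mourre's limiting absorption principle; NOT in the tree). Second step of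
L3 of the proof map (ABG Thm 6.2.5 by route (b): smooth functions of `H` as Fourier integrals over
the norm-continuous unitary groups `e^{iτB}` of bounded self-adjoint `B` in the resolvent algebra),
over `…LAPExpUnitary` (the group `expI B τ = e^{iτB}`, its covariance `𝒲(x)[e^{iτB}] = e^{iτ𝒲(x)B}`
and the Duhamel bounds):

* `B ∈ C¹(A; H) ⇒ e^{iτB} ∈ C¹(A; H)` with the commutator `expIComm B D τ = Σ_n c_n(τ) [Bⁿ, iA]`
  (term-wise strong differentiation of the exponential series; `[Bⁿ, iA]` by the Leibniz rule);
* `‖[e^{iτB}, iA]‖ ≤ |τ| ‖[B, iA]‖` for self-adjoint `B` (from the Lipschitz bound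
  `‖𝒲(x)[e^{iτB}] - e^{iτB}‖ ≤ |τ| |x| ‖[B, iA]‖`), and norm continuity of `τ ↦ [e^{iτB}, iA]`;
* the `𝒞^{1,1}` integrand bound `‖[𝒲(x)-1]² e^{iτB}‖/x² ≤ |τ| ‖[𝒲(x)-1]² B‖/x² + 2τ²‖[B, iA]‖²`
  (polynomial in `τ`), hence `B ∈ C¹ ∩ 𝒞^{1,1} ⇒ e^{iτB} ∈ 𝒞^{1,1}` (headline
  `expUnitary_regular_of_regular`).
-/

noncomputable section

open MeasureTheory Complex Filter Topology Set
open scoped InnerProductSpace ComplexConjugate ENNReal NNReal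

namespace Summit.AtomisticToContinuum.FouriersLaw.Theorems.MourreDissolution

open Literature.Analysis.UnboundedOperators
open Literature.Analysis.UnboundedOperators.UnitaryRep

variable {H : Type*} [NormedAddCommGroup H] [InnerProductSpace ℂ H] [CompleteSpace H]

/-! ## §1. Regularity of `e^{iτB}` relative to the conjugate operator -/

/-- **Commutator norm from a Lipschitz bound**: if `x ↦ 𝒲(x)[S]` has strong derivative `D'` at
`0` and `‖𝒲(x)[S] - S‖ ≤ C |x|` for all `x`, then `‖D'‖ ≤ C`. [folklore] -/
theorem norm_le_of_hasCommutator_of_lipschitz {A : OneParameterUnitaryGroup H} {S D' : H →L[ℂ] H}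
    (h : A.HasCommutator S D') {C : ℝ} (hC : 0 ≤ C)
    (hlip : ∀ x : ℝ, ‖A.conjAut x S - S‖ ≤ C * |x|) : ‖D'‖ ≤ C := by
  refine ContinuousLinearMap.opNorm_le_bound _ hC fun f => ?_
  have ht := ((h f).tendsto_slope_zero).norm
  simp only [zero_add, conjAut_zero] at ht
  refine le_of_tendsto ht ?_
  filter_upwards [self_mem_nhdsWithin] with t (ht0 : t ≠ 0)
  have h1 : ‖A.conjAut t S f - S f‖ ≤ C * |t| * ‖f‖ := by
    rw [← _root_.sub_apply]
    exact (ContinuousLinearMap.le_opNorm _ _).trans (by gcongr; exact hlip t)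
  have ht' : 0 < |t| := abs_pos.2 ht0
  rw [norm_smul, norm_inv, Real.norm_eq_abs]
  calc |t|⁻¹ * ‖A.conjAut t S f - S f‖ ≤ |t|⁻¹ * (C * |t| * ‖f‖) := by gcongr
    _ = C * ‖f‖ := by field_simp

/-- The commutators of the powers `Bⁿ`: `D₀ = 0`, `D_{n+1} = D_n B + Bⁿ D` (Leibniz rule).
[folklore] -/
def powComm (B D : H →L[ℂ] H) : ℕ → (H →L[ℂ] H)
  | 0 => 0
  | n + 1 => powComm B D n * B + B ^ n * D

/-- **`[Bⁿ, iA] = D_n`** for `B ∈ C¹(A; H)` with `[B, iA] = D`. [cite: AmreinBoutetdeMonvelGeorgescu1996, Prop. 5.1.5] -/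
theorem hasCommutator_pow {A : OneParameterUnitaryGroup H} {B D : H →L[ℂ] H}
    (h : A.HasCommutator B D) : ∀ n : ℕ, A.HasCommutator (B ^ n) (powComm B D n)
  | 0 => by simpa [powComm, pow_zero] using A.hasCommutator_one
  | n + 1 => by
      rw [pow_succ]
      exact (hasCommutator_pow h n).mul h

omit [CompleteSpace H] in
/-- `‖Bⁿ‖ ≤ (‖B‖ + 1)ⁿ`. [folklore] -/
theorem norm_pow_le_succ_pow (B : H →L[ℂ] H) : ∀ n : ℕ, ‖B ^ n‖ ≤ (‖B‖ + 1) ^ n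
  | 0 => by
      rw [pow_zero, pow_zero]
      exact ContinuousLinearMap.norm_id_le
  | n + 1 => by
      rw [pow_succ, pow_succ]
      calc ‖B ^ n * B‖ ≤ ‖B ^ n‖ * ‖B‖ := norm_mul_le _ _
        _ ≤ (‖B‖ + 1) ^ n * (‖B‖ + 1) := by
            gcongr
            · exact norm_pow_le_succ_pow B n
            · linarith

omit [CompleteSpace H] in
/-- `‖D_n‖ ≤ n (‖B‖ + 1)ⁿ ‖D‖`. [folklore] -/
theorem norm_powComm_le (B D : H →L[ℂ] H) :
    ∀ n : ℕ, ‖powComm B D n‖ ≤ n * (‖B‖ + 1) ^ n * ‖D‖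
  | 0 => by simp [powComm]
  | n + 1 => by
      have ih := norm_powComm_le B D n
      have hK : 1 ≤ ‖B‖ + 1 := by linarith [norm_nonneg B]
      have h0 : 0 ≤ (‖B‖ + 1) ^ n * ‖D‖ := by positivity
      calc ‖powComm B D (n + 1)‖ = ‖powComm B D n * B + B ^ n * D‖ := rfl
        _ ≤ ‖powComm B D n‖ * ‖B‖ + ‖B ^ n‖ * ‖D‖ :=
            norm_add_le_of_le (norm_mul_le _ _) (norm_mul_le _ _)
        _ ≤ (n * (‖B‖ + 1) ^ n * ‖D‖) * (‖B‖ + 1) + (‖B‖ + 1) ^ n * ‖D‖ * (‖B‖ + 1) := by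
            have t1 : ‖powComm B D n‖ * ‖B‖ ≤ (n * (‖B‖ + 1) ^ n * ‖D‖) * (‖B‖ + 1) :=
              mul_le_mul ih (by linarith) (norm_nonneg _) (by positivity)
            have t2 : ‖B ^ n‖ * ‖D‖ ≤ (‖B‖ + 1) ^ n * ‖D‖ * (‖B‖ + 1) :=
              calc ‖B ^ n‖ * ‖D‖ ≤ (‖B‖ + 1) ^ n * ‖D‖ := by
                    gcongr; exact norm_pow_le_succ_pow B n
                _ ≤ (‖B‖ + 1) ^ n * ‖D‖ * (‖B‖ + 1) := le_mul_of_one_le_right h0 hK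
            linarith
        _ = (n + 1 : ℕ) * (‖B‖ + 1) ^ (n + 1) * ‖D‖ := by push_cast; ring

/-- The exponential coefficients `c_n(τ) = (iτ)ⁿ/n!`. [folklore] -/
def expICoeff (τ : ℝ) (n : ℕ) : ℂ := ((n.factorial : ℂ))⁻¹ * ((τ : ℂ) * I) ^ n

/-- `‖c_n(τ)‖ = |τ|ⁿ / n!`. [folklore] -/
theorem norm_expICoeff (τ : ℝ) (n : ℕ) : ‖expICoeff τ n‖ = |τ| ^ n / n.factorial := by
  rw [expICoeff, norm_mul, norm_inv, norm_pow, norm_mul, Complex.norm_real, Complex.norm_I,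
    mul_one, Real.norm_eq_abs, Complex.norm_natCast]
  ring

/-- **The exponential series** `e^{iτB} = Σ c_n(τ) Bⁿ`. [folklore] -/
theorem expI_hasSum (B : H →L[ℂ] H) (τ : ℝ) :
    HasSum (fun n : ℕ => expICoeff τ n • B ^ n) (expI B τ) := by
  have h := NormedSpace.exp_series_hasSum_exp' (𝕂 := ℂ) (((τ : ℂ) * I) • B)
  have e : τ • (I • B) = ((τ : ℂ) * I) • B := by rw [← Complex.coe_smul, smul_smul]
  have e2 : (fun n : ℕ => expICoeff τ n • B ^ n) =
      fun n => ((n.factorial : ℂ))⁻¹ • (((τ : ℂ) * I) • B) ^ n := by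
    funext n
    rw [smul_pow, smul_smul, expICoeff]
  unfold expI
  rw [e, e2]
  exact h

omit [CompleteSpace H] in
/-- Summability of the weights `|τ|ⁿ/n! · n (‖B‖+1)ⁿ ‖D‖` controlling the commutator series
(comparison with `(2|τ|(‖B‖+1))ⁿ/n!`). [folklore] -/
theorem summable_expICoeff_mul (τ : ℝ) (B D : H →L[ℂ] H) :
    Summable fun n : ℕ => ‖expICoeff τ n‖ * (n * (‖B‖ + 1) ^ n * ‖D‖) := by
  have hs := (Real.summable_pow_div_factorial (2 * |τ| * (‖B‖ + 1))).mul_right ‖D‖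
  refine Summable.of_nonneg_of_le (fun n => by positivity) (fun n => ?_) hs
  rw [norm_expICoeff]
  have hn : (n : ℝ) ≤ 2 ^ n := by exact_mod_cast Nat.lt_two_pow_self.le
  have h0 : 0 ≤ |τ| ^ n / n.factorial * (‖B‖ + 1) ^ n * ‖D‖ := by positivity
  calc |τ| ^ n / n.factorial * (n * (‖B‖ + 1) ^ n * ‖D‖)
      = n * (|τ| ^ n / n.factorial * (‖B‖ + 1) ^ n * ‖D‖) := by ring
    _ ≤ 2 ^ n * (|τ| ^ n / n.factorial * (‖B‖ + 1) ^ n * ‖D‖) := by gcongr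
    _ = (2 * |τ| * (‖B‖ + 1)) ^ n / n.factorial * ‖D‖ := by rw [mul_pow, mul_pow]; ring

/-- The commutator series `Σ c_n(τ) D_n` converges in operator norm. [folklore] -/
theorem summable_expICoeff_smul_powComm (τ : ℝ) (B D : H →L[ℂ] H) :
    Summable fun n : ℕ => expICoeff τ n • powComm B D n := by
  refine Summable.of_norm_bounded (summable_expICoeff_mul τ B D) fun n => ?_
  rw [norm_smul]
  gcongr
  exact norm_powComm_le B D n

/-- **The commutator of `e^{iτB}`**: `expIComm B D τ = Σ_n c_n(τ) D_n` (`= i∫₀^τ e^{iσB} D e^{i(τ-σ)B} dσ`).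
[folklore] -/
def expIComm (B D : H →L[ℂ] H) (τ : ℝ) : H →L[ℂ] H :=
  ∑' n : ℕ, expICoeff τ n • powComm B D n

/-- **`B ∈ C¹(A; H) ⇒ e^{iτB} ∈ C¹(A; H)` with `[e^{iτB}, iA] = Σ c_n(τ) [Bⁿ, iA]`** (term-wise
strong differentiation of `x ↦ 𝒲(x)[e^{iτB}] f = Σ c_n(τ) 𝒲(x)[Bⁿ] f`, the derivatives
`c_n(τ) 𝒲(x)[D_n] f` being summable uniformly in `x`). [cite: AmreinBoutetdeMonvelGeorgescu1996, Prop. 5.1.5] -/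
theorem hasCommutator_expI {A : OneParameterUnitaryGroup H} {B D : H →L[ℂ] H}
    (h : A.HasCommutator B D) (τ : ℝ) : A.HasCommutator (expI B τ) (expIComm B D τ) := by
  intro f
  -- evaluation of `S ↦ 𝒲(y)[S] f` as a continuous linear functional on `B(H)`
  set Φ : ℝ → (H →L[ℂ] H) →L[ℂ] H := fun y =>
    (A.appReal (-y)).comp (ContinuousLinearMap.apply ℂ H (A.appReal y f)) with hΦ
  have hΦapply : ∀ y S, Φ y S = A.conjAut y S f := fun y S => rfl
  have hsum_g : ∀ y : ℝ, HasSum (fun n => expICoeff τ n • A.conjAut y (B ^ n) f)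
      (A.conjAut y (expI B τ) f) := by
    intro y
    have := (expI_hasSum B τ).mapL (Φ y)
    simp only [map_smul] at this
    exact this
  have hu := (summable_expICoeff_mul τ B D).mul_right ‖f‖
  have hderiv := hasDerivAt_tsum (g := fun n y => expICoeff τ n • A.conjAut y (B ^ n) f)
    (g' := fun n y => expICoeff τ n • A.conjAut y (powComm B D n) f) (y₀ := 0) hu
    (fun n y => ((hasCommutator_pow h n).hasDerivAt_conjAut y f).const_smul (expICoeff τ n))
    (fun n y => by
      rw [norm_smul, mul_assoc]
      gcongr
      calc ‖A.conjAut y (powComm B D n) f‖ ≤ ‖A.conjAut y (powComm B D n)‖ * ‖f‖ :=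
            ContinuousLinearMap.le_opNorm _ _
        _ ≤ n * (‖B‖ + 1) ^ n * ‖D‖ * ‖f‖ := by
            rw [norm_conjAut]; gcongr; exact norm_powComm_le B D n)
    (hsum_g 0).summable 0
  have e1 : (fun z : ℝ => ∑' n, expICoeff τ n • A.conjAut z (B ^ n) f) =
      fun z => A.conjAut z (expI B τ) f := funext fun z => (hsum_g z).tsum_eq
  have e2 : (∑' n, expICoeff τ n • A.conjAut 0 (powComm B D n) f) = expIComm B D τ f := by
    simp only [conjAut_zero]
    have := ((summable_expICoeff_smul_powComm τ B D).hasSum.mapL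
      (ContinuousLinearMap.apply ℂ H f)).tsum_eq
    simp only [ContinuousLinearMap.apply_apply, FunLike.coe_smul, Pi.smul_apply]
      at this
    rw [expIComm]
    exact this
  rw [e1, e2] at hderiv
  exact hderiv

/-- `B ∈ C¹(A; H) ⇒ e^{iτB} ∈ C¹(A; H)`. [cite: AmreinBoutetdeMonvelGeorgescu1996, Prop. 5.1.5] -/
theorem isOfClassC1_expI {A : OneParameterUnitaryGroup H} {B : H →L[ℂ] H} (h : A.IsOfClassC1 B)
    (τ : ℝ) : A.IsOfClassC1 (expI B τ) :=
  (hasCommutator_expI h.hasCommutator τ).isOfClassC1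

/-- **Lipschitz bound along the conjugate group**: `‖𝒲(x)[e^{iτB}] - e^{iτB}‖ ≤ |τ| |x| ‖[B, iA]‖`
for self-adjoint `B ∈ C¹(A; H)`. [folklore] -/
theorem norm_conjAut_expI_sub_le {A : OneParameterUnitaryGroup H} {B D : H →L[ℂ] H}
    (hB : IsSelfAdjoint B) (h : A.HasCommutator B D) (x τ : ℝ) :
    ‖A.conjAut x (expI B τ) - expI B τ‖ ≤ |τ| * (|x| * ‖D‖) := by
  rw [conjAut_expI]
  exact (norm_expI_sub_expI_le hB (isSelfAdjoint_conjAut A x hB) τ).trans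
    (by gcongr; exact norm_conjAut_sub_le h x)

/-- **`‖[e^{iτB}, iA]‖ ≤ |τ| ‖[B, iA]‖`** for self-adjoint `B ∈ C¹(A; H)` (linear growth in `τ`).
[folklore] -/
theorem norm_expIComm_le {A : OneParameterUnitaryGroup H} {B D : H →L[ℂ] H}
    (hB : IsSelfAdjoint B) (h : A.HasCommutator B D) (τ : ℝ) : ‖expIComm B D τ‖ ≤ |τ| * ‖D‖ :=
  norm_le_of_hasCommutator_of_lipschitz (hasCommutator_expI h τ) (by positivity) fun x => by
    calc ‖A.conjAut x (expI B τ) - expI B τ‖ ≤ |τ| * (|x| * ‖D‖) := norm_conjAut_expI_sub_le hB h x τ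
      _ = |τ| * ‖D‖ * |x| := by ring

/-- `‖[e^{iτB}, iA]‖ ≤ |τ| ‖[B, iA]‖` in terms of `commutatorCLM`. [folklore] -/
theorem norm_commutatorCLM_expI_le {A : OneParameterUnitaryGroup H} {B : H →L[ℂ] H}
    (hB : IsSelfAdjoint B) (h : A.IsOfClassC1 B) (τ : ℝ) :
    ‖A.commutatorCLM (expI B τ)‖ ≤ |τ| * ‖A.commutatorCLM B‖ := by
  rw [(hasCommutator_expI h.hasCommutator τ).commutatorCLM_eq]
  exact norm_expIComm_le hB h.hasCommutator τ

/-- The group law for commutators: `[e^{i(σ+τ)B}, iA] = [e^{iσB}, iA] e^{iτB} + e^{iσB} [e^{iτB}, iA]`.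
[folklore] -/
theorem expIComm_add {A : OneParameterUnitaryGroup H} {B D : H →L[ℂ] H}
    (h : A.HasCommutator B D) (σ τ : ℝ) :
    expIComm B D (σ + τ) = expIComm B D σ * expI B τ + expI B σ * expIComm B D τ := by
  have h1 := hasCommutator_expI h (σ + τ)
  rw [expI_add] at h1
  exact h1.unique ((hasCommutator_expI h σ).mul (hasCommutator_expI h τ))

/-- **Norm continuity of `τ ↦ [e^{iτB}, iA]`** for self-adjoint `B ∈ C¹(A; H)` (group law:
`‖[e^{iτB}, iA] - [e^{iτ₀B}, iA]‖ ≤ ‖[e^{iτ₀B}, iA]‖ ‖e^{i(τ-τ₀)B} - 1‖ + |τ - τ₀| ‖[B, iA]‖`).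
[folklore] -/
theorem continuous_expIComm {A : OneParameterUnitaryGroup H} {B D : H →L[ℂ] H}
    (hB : IsSelfAdjoint B) (h : A.HasCommutator B D) : Continuous fun τ : ℝ => expIComm B D τ := by
  refine continuous_iff_continuousAt.2 fun τ₀ => ?_
  rw [ContinuousAt, tendsto_iff_norm_sub_tendsto_zero]
  have key : ∀ τ : ℝ, ‖expIComm B D τ - expIComm B D τ₀‖ ≤
      ‖expIComm B D τ₀‖ * ‖expI B (τ - τ₀) - 1‖ + |τ - τ₀| * ‖D‖ := by
    intro τ
    have e : expIComm B D τ = expIComm B D τ₀ * expI B (τ - τ₀) +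
        expI B τ₀ * expIComm B D (τ - τ₀) := by
      rw [← expIComm_add h, add_sub_cancel]
    have e' : expIComm B D τ - expIComm B D τ₀ =
        expIComm B D τ₀ * (expI B (τ - τ₀) - 1) + expI B τ₀ * expIComm B D (τ - τ₀) := by
      rw [e, mul_sub, mul_one]; abel
    rw [e']
    refine norm_add_le_of_le (norm_mul_le _ _) ((norm_mul_le _ _).trans ?_)
    calc ‖expI B τ₀‖ * ‖expIComm B D (τ - τ₀)‖ ≤ 1 * (|τ - τ₀| * ‖D‖) :=
          mul_le_mul (norm_expI_le_one hB τ₀) (norm_expIComm_le hB h _) (norm_nonneg _) zero_le_one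
      _ = |τ - τ₀| * ‖D‖ := one_mul _
  have hlim : Tendsto (fun τ : ℝ => ‖expIComm B D τ₀‖ * ‖expI B (τ - τ₀) - 1‖ + |τ - τ₀| * ‖D‖)
      (𝓝 τ₀) (𝓝 0) := by
    have h1 : Tendsto (fun τ : ℝ => τ - τ₀) (𝓝 τ₀) (𝓝 0) := by
      simpa using (tendsto_id (x := 𝓝 τ₀)).sub_const τ₀
    have h2 : Tendsto (fun τ : ℝ => ‖expI B (τ - τ₀) - 1‖) (𝓝 τ₀) (𝓝 0) := by
      have hc := (((continuous_expI B).tendsto 0).comp h1).sub_const (1 : H →L[ℂ] H)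
      simp only [Function.comp_def, expI_zero, sub_self] at hc
      simpa using hc.norm
    have h3 : Tendsto (fun τ : ℝ => |τ - τ₀|) (𝓝 τ₀) (𝓝 0) := by simpa using h1.abs
    simpa using ((h2.const_mul ‖expIComm B D τ₀‖).add (h3.mul_const ‖D‖))
  exact squeeze_zero (fun τ => norm_nonneg _) key hlim

/-- Norm continuity of `τ ↦ [e^{iτB}, iA]` in terms of `commutatorCLM`. [folklore] -/
theorem continuous_commutatorCLM_expI {A : OneParameterUnitaryGroup H} {B : H →L[ℂ] H}
    (hB : IsSelfAdjoint B) (h : A.IsOfClassC1 B) :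
    Continuous fun τ : ℝ => A.commutatorCLM (expI B τ) := by
  have e : (fun τ : ℝ => A.commutatorCLM (expI B τ)) = fun τ => expIComm B (A.commutatorCLM B) τ :=
    funext fun τ => (hasCommutator_expI h.hasCommutator τ).commutatorCLM_eq
  rw [e]
  exact continuous_expIComm hB h.hasCommutator

/-- **The `𝒞^{1,1}` integrand of `e^{iτB}` is polynomially bounded in `τ`**:
`‖[𝒲(x) - 1]² e^{iτB}‖ / x² ≤ |τ| ‖[𝒲(x) - 1]² B‖ / x² + 2 τ² ‖[B, iA]‖²`. [folklore] -/
theorem secondDifference_expI_div_sq_le {A : OneParameterUnitaryGroup H} {B D : H →L[ℂ] H}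
    (hB : IsSelfAdjoint B) (h : A.HasCommutator B D) (x τ : ℝ) :
    ‖A.secondDifference x (expI B τ)‖ / x ^ 2 ≤
      |τ| * (‖A.secondDifference x B‖ / x ^ 2) + 2 * τ ^ 2 * ‖D‖ ^ 2 := by
  by_cases hx : x = 0
  · subst hx
    simp only [secondDifference_zero, norm_zero, zero_div, mul_zero, zero_add]
    positivity
  have hx2 : 0 < x ^ 2 := by positivity
  have h1 := norm_secondDifference_expI_le A hB x τ
  have h2 : ‖A.conjAut x B - B‖ ^ 2 ≤ (|x| * ‖D‖) ^ 2 :=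
    pow_le_pow_left₀ (norm_nonneg _) (norm_conjAut_sub_le h x) 2
  have h3 : ‖A.secondDifference x (expI B τ)‖ ≤
      |τ| * ‖A.secondDifference x B‖ + 2 * τ ^ 2 * ‖D‖ ^ 2 * x ^ 2 := by
    calc ‖A.secondDifference x (expI B τ)‖
        ≤ |τ| * (‖A.secondDifference x B‖ + 2 * |τ| * (|x| * ‖D‖) ^ 2) := h1.trans (by gcongr)
      _ = |τ| * ‖A.secondDifference x B‖ + 2 * |τ| ^ 2 * ‖D‖ ^ 2 * |x| ^ 2 := by ring
      _ = |τ| * ‖A.secondDifference x B‖ + 2 * τ ^ 2 * ‖D‖ ^ 2 * x ^ 2 := by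
          rw [sq_abs, sq_abs]
  rw [div_le_iff₀ hx2]
  refine h3.trans (le_of_eq ?_)
  field_simp

/-- **`B ∈ C¹ ∩ 𝒞^{1,1}` self-adjoint ⇒ `e^{iτB} ∈ 𝒞^{1,1}(A; H)`.** [cite: AmreinBoutetdeMonvelGeorgescu1996, Thm. 6.2.5] -/
theorem isOfClassC11_expI {A : OneParameterUnitaryGroup H} {B : H →L[ℂ] H} (hB : IsSelfAdjoint B)
    (h1 : A.IsOfClassC1 B) (h11 : A.IsOfClassC11 B) (τ : ℝ) : A.IsOfClassC11 (expI B τ) := by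
  obtain ⟨D, hD⟩ := h1
  exact isOfClassC11_of_le h11 (abs_nonneg τ) (b := 2 * τ ^ 2 * ‖D‖ ^ 2) (by positivity)
    fun x _ => secondDifference_expI_div_sq_le hB hD x τ

/-! ## §2. Headline (registered helper stub) -/

/-- **Regularity of the unitary group of a bounded regular self-adjoint operator, headline form**
(all binders explicit; registered helper stub of `stub_mourreThresholdLAP`): for self-adjoint
`B ∈ C¹(A; H) ∩ 𝒞^{1,1}(A; H)` and every `τ`, `e^{iτB} ∈ C¹(A; H) ∩ 𝒞^{1,1}(A; H)` with
`‖[e^{iτB}, iA]‖ ≤ |τ| ‖[B, iA]‖`. [cite: AmreinBoutetdeMonvelGeorgescu1996, Thm. 6.2.5] -/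
theorem expUnitary_regular_of_regular :
    ∀ (K : Type) [NormedAddCommGroup K] [InnerProductSpace ℂ K] [CompleteSpace K]
      (A : Literature.Analysis.UnboundedOperators.OneParameterUnitaryGroup K) (B : K →L[ℂ] K)
      (τ : ℝ), IsSelfAdjoint B → A.IsOfClassC1 B → A.IsOfClassC11 B →
        A.IsOfClassC1 (Summit.AtomisticToContinuum.FouriersLaw.Theorems.MourreDissolution.expI B τ) ∧
          A.IsOfClassC11
              (Summit.AtomisticToContinuum.FouriersLaw.Theorems.MourreDissolution.expI B τ) ∧
            ‖A.commutatorCLM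
                (Summit.AtomisticToContinuum.FouriersLaw.Theorems.MourreDissolution.expI B τ)‖ ≤
              |τ| * ‖A.commutatorCLM B‖ := by
  intro K _ _ _ A B τ hB h1 h11
  exact ⟨isOfClassC1_expI h1 τ, isOfClassC11_expI hB h1 h11 τ, norm_commutatorCLM_expI_le hB h1 τ⟩

end Summit.AtomisticToContinuum.FouriersLaw.Theorems.MourreDissolution
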